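import Summits.BirchSwinnertonDyer.Rank1Residual.X10.ResidualSelmerGeneratorTestGroupForm
import Summits.BirchSwinnertonDyer.Rank1Residual.X10.ResidualSelmerGroupBinders
import Summits.BirchSwinnertonDyer.Rank1Residual.X10.ResidualSelmerReciprocity
import Summits.BirchSwinnertonDyer.Rank1Residual.X10.ResidualSelmerLocalDuality
import Summits.BirchSwinnertonDyer.Rank1Residual.X10.ResidualSelmerUnramifiedDuality
import Summits.BirchSwinnertonDyer.Rank1Residual.X10.ResidualSelmerPoitouTate
import Summits.BirchSwinnertonDyer.Rank1Residual.X10.ResidualSelmerLocalCounts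
import Summits.BirchSwinnertonDyer.Rank1Residual.X10.ResidualSelmerLocalTerm
import Summits.BirchSwinnertonDyer.Rank1Residual.Additive.RationalClassesToLayerZero
import Literature.NumberTheory.EllipticCurves.WeilPairingProofs
import Literature.NumberTheory.GaloisRepresentations.AbsGaloisGroupCompact
import HarnessLib

/-!
# The `E[p]` instance of the N2 parity law, PART VIII — ASSEMBLY: Mazur–Rubin's parity law (P)
# `dim Sel_p(E) + dim S⁰(E) + #T_E ≡ 0 (mod 2)`, its NO-GO form and the generator tests (G) for
# `H¹(K, E[p])`, modulo the ONE Poitou–Tate fact and the local term at the `T_E`-places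
# (cell `b2b-bsdres`, unit `b2b-bsdres-x10` = N2 class lead, GEN 31; theorems only, no definition,
# ONE named-fact hypothesis `poitouTate_selmerStructure_duality K` (→ conditional), nothing booked)

HONEST FRAMING (run/shared/lean/b2b/bsd-rank1-residual/, verbatim in every file): the goal of the
cell is to DELETE the COMBINATION-SHAPED residual classes of the Birch–Swinnerton-Dyer formula for
ALL analytic-rank `≤ 1` elliptic curves over `ℚ` — "full BSD formula for every rank `≤ 1` curve in
class `C`" assembled STRICTLY from published theorems — so that the rank-`≤ 1` remainder becomes
exactly the CONSTRUCTION-SHAPED classes, which are TYPED (missing-input `Prop`s), NOT attempted.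
This is not "finishing BSD". Class X10b (= N2) keeps its label CONSTRUCTION-SHAPED (NEEDS `X_A3`,
referee R82.3 / RESIDUAL-MAP §I N2); this file is a TOOL; no mark / label / tier / count moves.

## What

The group-currency parity law `ResidualSelmerParityGroupForm.even_and_generatorTest_groupForm`
(x10 GEN 31, PARTS 0: Mazur–Rubin 2007 Prop. 1.3 / Thm. 1.4 with Klagsbrun–Mazur–Rubin 2013 Thm. 3.9,
for abstract `p`-torsion groups, subgroups by membership and bi-additive local pairings) APPLIED to
the dictionary of `class-closure/N2/P-INSTANCE-ASK-x10g31.md` §1: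
`H = H¹(K, E[p])`, `L_v = H¹(K_v, E[p])`, `loc_v` the localisation, `X = 𝓛` the Kummer conditions,
`Λ = residualSelmerStructure W p` (unramified at the finite `v ∤ p`, Kummer above `p` and at `∞`),
`Sel = Sel_p(E) = W.selmerGroup p`, `S0 = S⁰(E) = residualSelmerGroup W p`, and
`b_v(x, y) = inv_v(x ∪_{e,v} y)` for a Weil pairing `e` on `E[p]` (PROVED to exist:
`exists_weilPairing_holds`) and a Poitou–Tate family `inv` (the ONE named fact
`poitouTate_selmerStructure_duality K`: `IsPerfect ∧ SumLocalTermEqZero ∧ UnramifiedOrthogonal ∧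
SelmerComplement`). Every binder of the law is a theorem of PARTS I–VII:
`hH` (tree, `Additive.smul_galH1Torsion_eq_zero`), `hL`/`hoff`/`hSel`/`hS0`/`hfin` (PART I,
`ResidualSelmerGroupBinders`), `hsymm` (`WeilCupSymmetric`), `hnd`/`hX` (PART II,
`ResidualSelmerLocalDuality`, with the count of PART VI), `hΛ` (PART IV,
`ResidualSelmerUnramifiedDuality`, with the count of PART VI — any reduction type), `hrec` (PART III,
`ResidualSelmerReciprocity`), `hPT` (PART V, `ResidualSelmerPoitouTate`).

What stays DISPLAYED: (a) the fact; (b) nothing else of the cohomological set-up (the LOCAL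
instance `LocallyCompactSpace Γ_{K_v}` of the tree is supplied inside the proofs from
`absoluteGaloisGroup_compactSpace`); (c) the orders `#Sel_p(E) = p^s`, `#S⁰(E) = p^{s₀}` as exponents
(both groups are finite `p`-groups); (d) the reduction data of `S`, `T` (census INPUTS: `T` = the
split multiplicative `v ∤ p` with `p ∣ c_v`, the other bad `v ∤ p` Tamagawa-`p`-free). The LOCAL
TERM `#𝓛_v = p · #(𝓛_v ⊓ H¹_ur)` at `v ∈ T` is PART IX (`ResidualSelmerLocalTerm`, ASK G8); the
`hterm` forms keep it displayed for other kinds of exceptional places.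

* §1 `forall_not_mem_residual_iff` — outside `S ⊇ {v ∣ ∞} ∪ {v ∣ p}` "residual" IS "unramified".
* §2 `exists_groupForm_data` — the pairing data `b` with `hsymm`, `hnd`, `hΛ`, `hX`, `hrec`, `hPT`
  for `S ⊇ {v ∣ ∞} ∪ {v ∣ p} ∪ {bad v}` and `{v ∣ ∞} ∪ {v ∣ p} ⊆ P ⊆ S`, from the fact.
* §3 `even_add_add_card` — **(P) for `E[p]`**: with `T ⊆ S` finite places `∤ p` carrying the local
  term and `S \\ T` Tamagawa-`p`-free away from `p`: `#Sel_p(E) = p^s`, `#S⁰(E) = p^{s₀}` ⟹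
  `Even (s + s₀ + #T)`; `hterm_of_split` + `even_add_add_card_of_split` — the same with the local
  term DISCHARGED for `T` = split multiplicative places `v ∤ p` with `p ∣ c_v` (PART IX).
* §4 `residualSelmerGroup_ne_bot_of_odd`, `residualSelmerGroup_ne_bot_of_odd_of_split` — **NO-GO
  form**: `#Sel_p(E) = p^s`, `s + #T` odd ⟹ `S⁰(E) ≠ ⊥` (the 25 NOGO-parity cells of N2: every
  `T_E`-prime is split multiplicative with `3 ∣ c_ℓ`).
The generator tests (G) are in `X10/ResidualSelmerGeneratorTestInstance.lean`.

References: [MazurRubin2007] Def. 1.2, Prop. 1.3, Thm. 1.4; [KlagsbrunMazurRubin2013] Thm. 3.1, 3.9;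
[MilneADT2006] I 2.3, 2.6, 2.8, 2.9, 3.3, 4.10; [Howard2004HeegnerKolyvagin] Thm. 2.1.11;
HOME/class-closure/N2/P-INSTANCE-ASK-x10g31.md; HOME/X10-AUDIT.md §§35–37.
-/

set_option autoImplicit false

noncomputable section

open scoped Classical

open Function WeierstrassCurve Field Literature.NumberTheory.EllipticCurves
  Literature.NumberTheory.GaloisRepresentations Literature.NumberTheory.GaloisCohomology NumberField
  IsDedekindDomain
open Literature.NumberTheory.GaloisRepresentations.DiscreteGaloisModule (unramifiedSubgroup SelmerStructure mu)
open Summit.BirchSwinnertonDyer.Rank1Residual.X10.ResidualSelmerGroup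
open Summit.BirchSwinnertonDyer.Rank1Residual.X10.ResidualSelmerGroupBinders
open Summit.BirchSwinnertonDyer.Rank1Residual.X10.ResidualSelmerReciprocity
open Summit.BirchSwinnertonDyer.Rank1Residual.X10.ResidualSelmerLocalDuality
open Summit.BirchSwinnertonDyer.Rank1Residual.X10.ResidualSelmerUnramifiedDuality
open Summit.BirchSwinnertonDyer.Rank1Residual.X10.ResidualSelmerPoitouTate
open Summit.BirchSwinnertonDyer.Rank1Residual.X10.ResidualSelmerLocalCounts
open Summit.BirchSwinnertonDyer.Rank1Residual.X10.ResidualSelmerLocalTerm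
open Summit.BirchSwinnertonDyer.Rank1Residual.X10.WeilCupSymmetric
open Summit.BirchSwinnertonDyer.Rank1Residual.X10.ResidualSelmerParityGroupForm
open Summit.BirchSwinnertonDyer.Rank1Residual.X10.ResidualSelmerGeneratorTestGroupForm

namespace Summit.BirchSwinnertonDyer.Rank1Residual.X10.ResidualSelmerParityInstance

variable {K : Type} [Field K] [NumberField K] (W : WeierstrassCurve K) [W.IsElliptic] (p : ℕ)
  [hp : Fact p.Prime]

/-! ### §1. Outside `S ⊇ {v ∣ ∞} ∪ {v ∣ p}`: residual = unramified; finiteness of the local groups -/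

omit [W.IsElliptic] hp in
/-- Outside a set of places containing the archimedean places and the places above `p`, "`loc_v c`
satisfies the residual condition" is "`loc_v c` is unramified" (there `Λ_v = H¹_ur`).
[cite: MazurRubin2007, Def. 1.2] -/
theorem forall_not_mem_residual_iff {S : Finset (Place K)}
    (hS : ∀ w : InfinitePlace K, (Sum.inl w : Place K) ∈ S)
    (hSp : ∀ v : HeightOneSpectrum (𝓞 K), (p : 𝓞 K) ∈ v.asIdeal → (Sum.inr v : Place K) ∈ S)
    (c : galH1Torsion W (p : ℤ)) :
    (∀ v, v ∉ S → galoisCohomology.localization (W.torsionGaloisModule (p : ℤ)) v 1 c ∈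
        residualSelmerStructure W p v) ↔
      ∀ v : HeightOneSpectrum (𝓞 K), (Sum.inr v : Place K) ∉ S →
        galoisCohomology.localization (W.torsionGaloisModule (p : ℤ)) (Sum.inr v) 1 c ∈
          unramifiedSubgroup (GaloisRep.toLocal v (W.torsionGaloisModule (p : ℤ))) 1 := by
  constructor
  · intro h v hv
    rw [← residualSelmerStructure_inr_of_not_mem W p (fun h' => hv (hSp v h'))]
    exact h (Sum.inr v) hv
  · rintro h (w | v) hv
    · exact absurd (hS w) hv
    · rw [residualSelmerStructure_inr_of_not_mem W p (fun h' => hv (hSp v h'))]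
      exact h v hv

/-- Every `H¹(K_v, E[p])` is finite (`p` odd): at the finite places by local finiteness
(Milne I 2.8 setting, `finite_galoisCohomology_one_of_isNonarchimedeanLocalField`), at the archimedean
places it is `0` (`ResidualSelmerLocalDuality.eq_zero_inl`). [cite: MilneADT2006, Ch. I, Thm. 2.8] -/
theorem finite_galoisCohomology_toLocal (hodd : Odd p) (v : Place K) :
    Finite (galoisCohomology ((W.torsionGaloisModule (p : ℤ)).toLocal v) 1) := by
  haveI : NeZero p := ⟨hp.out.ne_zero⟩
  haveI : Finite (geomTorsion W (p : ℤ)) := finite_geomTorsion_of_neZero W p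
  rcases v with w | v
  · haveI : Subsingleton (galoisCohomology ((W.torsionGaloisModule (p : ℤ)).toLocal (Sum.inl w)) 1) :=
      ⟨fun x y => by rw [eq_zero_inl W p hodd w x, eq_zero_inl W p hodd w y]⟩
    infer_instance
  · haveI : CharZero (v.adicCompletion K) := charZero_adicCompletion v
    exact finite_galoisCohomology_one_of_isNonarchimedeanLocalField
      (GaloisRep.toLocal v (W.torsionGaloisModule (p : ℤ)))

/-- **The local term at the `T_E`-places, discharged** (PART IX): if every `v ∈ T` is a finite
place `v ∤ p` of split multiplicative reduction with `p ∣ c_v(E)`, then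
`#𝓛_v = p · #(𝓛_v ⊓ Λ_v)` for all `v ∈ T` (`Λ_v = H¹_ur` there). [cite: MazurRubin2007, proof of Thm. 1.4] -/
theorem hterm_of_split {T : Finset (Place K)} (hT : ∀ w : InfinitePlace K, (Sum.inl w : Place K) ∉ T)
    (hTp : ∀ v : HeightOneSpectrum (𝓞 K), (Sum.inr v : Place K) ∈ T → (p : 𝓞 K) ∉ v.asIdeal)
    (hTsplit : ∀ v : HeightOneSpectrum (𝓞 K), (Sum.inr v : Place K) ∈ T →
      W.HasSplitMultiplicativeReductionAt v ∧
        p ∣ (W.baseChange (v.adicCompletion K)).localTamagawaNumber (v.adicCompletionIntegers K)) :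
    ∀ v ∈ T, Nat.card (W.kummerSelmerStructure (p : ℤ) v) =
      p * Nat.card ↥(W.kummerSelmerStructure (p : ℤ) v ⊓ residualSelmerStructure W p v) := by
  rintro (w | v) hv
  · exact absurd hv (hT w)
  · obtain ⟨hsplit, hc⟩ := hTsplit v hv
    rw [residualSelmerStructure_inr_of_not_mem W p (hTp v hv)]
    exact natCard_kummerLocalConditionAt_eq_mul W v (hTp v hv) hsplit hc

/-! ### §2. The pairing data of the law, from the Poitou–Tate fact -/

/-- **The group-currency inputs `b`, `hsymm`, `hnd`, `hΛ`, `hX`, `hrec`, `hPT` for `E[p]`.** For an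
odd prime `p`, a finite set of places `S ⊇ {v ∣ ∞} ∪ {v ∣ p} ∪ {bad v}` and `P` with
`{v ∣ ∞} ∪ {v ∣ p} ⊆ P ⊆ S`, the Poitou–Tate fact yields bi-additive `b_v : H¹(K_v, E[p])² → ℤ/p`
(namely `inv_v(· ∪_{e,v} ·)` for a Weil pairing `e`) which are symmetric (KMR 3.1(i)) and
non-degenerate (Milne I 2.3), for which `Λ_v = H¹_ur` (`v ∉ P`) and `𝓛_v` (`v ∈ S`) are their own
annihilators (Milne I 2.6, KMR 3.1(ii)), whose sum over `S' ⊇ P` vanishes on pairs of global classes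
residual outside `S'` (Milne I 4.10(b)), and with `Z^⊥ ⊆ Z` for `Z = loc_S` of the classes residual
outside `S` (Howard 2.1.11). [cite: KlagsbrunMazurRubin2013, Thm. 3.1 and proof of Thm. 3.9]
[cite: MilneADT2006, Ch. I, Cor. 2.3, Thm. 2.6 and Thm. 4.10(b)]
[cite: Howard2004HeegnerKolyvagin, Thm. 2.1.11 (arXiv:1202.6340 p. 6)] -/
theorem exists_groupForm_data (hp2 : p ≠ 2)
    (hfact : poitouTate_selmerStructure_duality K)
    {S P : Finset (Place K)} (hS : ∀ w : InfinitePlace K, (Sum.inl w : Place K) ∈ S)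
    (hSp : ∀ v : HeightOneSpectrum (𝓞 K), (p : 𝓞 K) ∈ v.asIdeal → (Sum.inr v : Place K) ∈ S)
    (hSbad : ∀ v : HeightOneSpectrum (𝓞 K), (Sum.inr v : Place K) ∉ S → W.HasGoodReductionAt v)
    (hP : ∀ w : InfinitePlace K, (Sum.inl w : Place K) ∈ P)
    (hPp : ∀ v : HeightOneSpectrum (𝓞 K), (p : 𝓞 K) ∈ v.asIdeal → (Sum.inr v : Place K) ∈ P) :
    ∃ b : ∀ v : Place K, galoisCohomology ((W.torsionGaloisModule (p : ℤ)).toLocal v) 1 →+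
        galoisCohomology ((W.torsionGaloisModule (p : ℤ)).toLocal v) 1 →+ ZMod p,
      (∀ v x y, b v x y = b v y x) ∧
      (∀ v x, (∀ y, b v x y = 0) → x = 0) ∧
      (∀ v, v ∉ P → ∀ x, x ∈ residualSelmerStructure W p v ↔
        ∀ y ∈ residualSelmerStructure W p v, b v x y = 0) ∧
      (∀ v ∈ S, ∀ x, x ∈ W.kummerSelmerStructure (p : ℤ) v ↔
        ∀ y ∈ W.kummerSelmerStructure (p : ℤ) v, b v x y = 0) ∧
      (∀ S' : Finset (Place K), P ⊆ S' → ∀ c d : galH1Torsion W (p : ℤ),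
        (∀ v, v ∉ S' → galoisCohomology.localization (W.torsionGaloisModule (p : ℤ)) v 1 c ∈
          residualSelmerStructure W p v) →
        (∀ v, v ∉ S' → galoisCohomology.localization (W.torsionGaloisModule (p : ℤ)) v 1 d ∈
          residualSelmerStructure W p v) →
        ∑ v ∈ S', b v (galoisCohomology.localization (W.torsionGaloisModule (p : ℤ)) v 1 c)
          (galoisCohomology.localization (W.torsionGaloisModule (p : ℤ)) v 1 d) = 0) ∧
      ∀ y : ∀ v : Place K, galoisCohomology ((W.torsionGaloisModule (p : ℤ)).toLocal v) 1,
        (∀ c : galH1Torsion W (p : ℤ),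
          (∀ v, v ∉ S → galoisCohomology.localization (W.torsionGaloisModule (p : ℤ)) v 1 c ∈
            residualSelmerStructure W p v) →
          ∑ v ∈ S, b v (galoisCohomology.localization (W.torsionGaloisModule (p : ℤ)) v 1 c) (y v) = 0) →
        ∃ c : galH1Torsion W (p : ℤ),
          (∀ v, v ∉ S → galoisCohomology.localization (W.torsionGaloisModule (p : ℤ)) v 1 c ∈
            residualSelmerStructure W p v) ∧
          ∀ v ∈ S, galoisCohomology.localization (W.torsionGaloisModule (p : ℤ)) v 1 c = y v := by
  haveI : ∀ v : Place K, LocallyCompactSpace (absoluteGaloisGroup (Place.Completion v)) :=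
    fun v => by haveI := absoluteGaloisGroup_compactSpace (Place.Completion v); infer_instance
  haveI : NeZero p := ⟨hp.out.ne_zero⟩
  have hodd : Odd p := hp.out.odd_of_ne_two hp2
  -- a Weil pairing on `E[p]` (PROVED in the tree)
  obtain ⟨e, hμ, hadd₁, hadd₂, halt, hnondeg, hgal⟩ :=
    exists_weilPairing_holds W p hp.out.two_le (Nat.cast_ne_zero.mpr hp.out.ne_zero)
  have hskew : ∀ S T, e T S = (e S T)⁻¹ := skew_of_alt W p e hμ hadd₁ hadd₂ halt
  -- the Poitou–Tate family (the ONE named fact)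
  obtain ⟨inv, hperf, hsum, hUO, hSC⟩ := hfact p
  have hinj : ∀ v : HeightOneSpectrum (𝓞 K), Injective (inv (Sum.inr v)) := fun v => (hperf v).1.injective
  -- the bi-additive local pairings
  obtain ⟨b, hb⟩ := exists_biadditive_invWeilCup W p e hμ hadd₁ hadd₂ hgal inv
  refine ⟨b, ?_, ?_, ?_, ?_, ?_, ?_⟩
  · exact fun v x y => invWeilCup_symm W p e hμ hadd₁ hadd₂ hgal hskew inv b hb v x y
  · exact fun v x hx => hnd_groupForm W p e hμ hadd₁ hadd₂ hgal hodd hnondeg inv hinj b hb v x hx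
  · exact hΛ_groupForm_of_forall W p e hμ hadd₁ hadd₂ hgal hnondeg inv hinj b hb
      (residualSelmerStructure W p) hP
      (fun v hv => residualSelmerStructure_inr_of_not_mem W p (fun h => hv (hPp v h)))
      (hcardΛ_groupForm W p hPp)
  · exact hX_groupForm W p e hμ hadd₁ hadd₂ hgal hodd halt hnondeg inv hinj b hb S (hcard_groupForm W p S)
  · exact hrec_of_sumLocalTermEqZero W p e hμ hadd₁ hadd₂ hgal inv hsum b hb hP hPp
  · intro y hy
    obtain ⟨c, hc, hcy⟩ := hPT_groupForm W p e hμ hadd₁ hadd₂ hgal hskew hnondeg inv hUO hSC b hb hS hSp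
      hSbad y (fun c hc => hy c ((forall_not_mem_residual_iff W p hS hSp c).2 hc))
    exact ⟨c, (forall_not_mem_residual_iff W p hS hSp c).2 hc, hcy⟩

/-! ### §3. (P) for `E[p]` -/

/-- **Mazur–Rubin's parity law (P) for `E[p]`** (Prop. 1.3 / Thm. 1.4 with KMR Thm. 3.9), modulo
the Poitou–Tate fact and the local term at the exceptional places. Let `p` be an odd prime, `S` a
finite set of places containing `{v ∣ ∞} ∪ {v ∣ p} ∪ {bad v}`, `T ⊆ S` a set of FINITE places
`v ∤ p` such that every finite `v ∈ S \\ T` with `v ∤ p` is Tamagawa-`p`-free, and suppose the local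
term `#𝓛_v = p · #(𝓛_v ⊓ Λ_v)` at every `v ∈ T`. If `#Sel_p(E) = p^s` and `#S⁰(E) = p^{s₀}` then
`s + s₀ + #T` is even. [cite: MazurRubin2007, Prop. 1.3 (i) and Thm. 1.4]
[cite: KlagsbrunMazurRubin2013, Thm. 3.9] -/
theorem even_add_add_card (hp2 : p ≠ 2)
    (hfact : poitouTate_selmerStructure_duality K)
    {S T : Finset (Place K)} (hS : ∀ w : InfinitePlace K, (Sum.inl w : Place K) ∈ S)
    (hSp : ∀ v : HeightOneSpectrum (𝓞 K), (p : 𝓞 K) ∈ v.asIdeal → (Sum.inr v : Place K) ∈ S)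
    (hSbad : ∀ v : HeightOneSpectrum (𝓞 K), (Sum.inr v : Place K) ∉ S → W.HasGoodReductionAt v)
    (hTS : T ⊆ S) (hT : ∀ w : InfinitePlace K, (Sum.inl w : Place K) ∉ T)
    (hTp : ∀ v : HeightOneSpectrum (𝓞 K), (Sum.inr v : Place K) ∈ T → (p : 𝓞 K) ∉ v.asIdeal)
    (htam : ∀ v : HeightOneSpectrum (𝓞 K), (Sum.inr v : Place K) ∈ S → (Sum.inr v : Place K) ∉ T →
      (p : 𝓞 K) ∉ v.asIdeal →
      ¬ p ∣ (W.baseChange (v.adicCompletion K)).localTamagawaNumber (v.adicCompletionIntegers K))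
    (hterm : ∀ v ∈ T, Nat.card (W.kummerSelmerStructure (p : ℤ) v) =
      p * Nat.card ↥(W.kummerSelmerStructure (p : ℤ) v ⊓ residualSelmerStructure W p v))
    {s s₀ : ℕ} (hs : Nat.card (W.selmerGroup (p : ℤ)) = p ^ s)
    (hs₀ : Nat.card (residualSelmerGroup W p) = p ^ s₀) :
    Even (s + s₀ + T.card) := by
  haveI : ∀ v : Place K, LocallyCompactSpace (absoluteGaloisGroup (Place.Completion v)) :=
    fun v => by haveI := absoluteGaloisGroup_compactSpace (Place.Completion v); infer_instance
  haveI : NeZero p := ⟨hp.out.ne_zero⟩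
  have hodd : Odd p := hp.out.odd_of_ne_two hp2
  haveI : ∀ v : Place K, Finite (galoisCohomology ((W.torsionGaloisModule (p : ℤ)).toLocal v) 1) :=
    finite_galoisCohomology_toLocal W p hodd
  -- `P = S \\ T ⊇ {v ∣ ∞} ∪ {v ∣ p}`
  have hP : ∀ w : InfinitePlace K, (Sum.inl w : Place K) ∈ S \ T :=
    fun w => Finset.mem_sdiff.mpr ⟨hS w, hT w⟩
  have hPp : ∀ v : HeightOneSpectrum (𝓞 K), (p : 𝓞 K) ∈ v.asIdeal → (Sum.inr v : Place K) ∈ S \ T :=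
    fun v hv => Finset.mem_sdiff.mpr ⟨hSp v hv, fun h => hTp v h hv⟩
  obtain ⟨b, hsymm, hnd, hΛ, hX, hrec, hPT⟩ :=
    exists_groupForm_data W p hp2 hfact hS hSp hSbad hP hPp
  refine (even_and_generatorTest_groupForm (ι := Place K) hp2
    (Summit.BirchSwinnertonDyer.Rank1Residual.Additive.smul_galH1Torsion_eq_zero W p)
    (nsmul_galoisCohomology_toLocal_eq_zero W p)
    (fun v => galoisCohomology.localization (W.torsionGaloisModule (p : ℤ)) v 1)
    (residualSelmerStructure W p) b (W.kummerSelmerStructure (p : ℤ)) hsymm hnd hΛ hX hrec hPT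
    (finite_residual_outside W p hSp hSbad) subset_rfl Finset.sdiff_subset
    (W.selmerGroup (p : ℤ)) (residualSelmerGroup W p)
    (mem_selmerGroup_iff_of_places W p hS hSp hSbad)
    (mem_residualSelmerGroup_iff_of_places W p (P := S \ T) fun v hv hpv =>
      htam v (Finset.mem_sdiff.mp hv).1 (Finset.mem_sdiff.mp hv).2 hpv)).1 T s s₀ ?_ ?_ hterm hs hs₀
  · -- `T ⊆ S \\ (S \\ T)`
    intro v hv
    exact Finset.mem_sdiff.mpr ⟨hTS hv, fun h => (Finset.mem_sdiff.mp h).2 hv⟩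
  · -- `hoff` is vacuous: `S \\ (S \\ T) ⊆ T`
    intro v hv hvT
    obtain ⟨hvS, hvP⟩ := Finset.mem_sdiff.mp hv
    exact absurd (Finset.mem_sdiff.mpr ⟨hvS, hvT⟩) hvP

/-- **(P) for `E[p]` with the local term discharged** (PART IX): `T` = the places of `S` that are
split multiplicative `v ∤ p` with `p ∣ c_v`, the other finite `v ∈ S`, `v ∤ p`, Tamagawa-`p`-free;
`#Sel_p(E) = p^s`, `#S⁰(E) = p^{s₀}` ⟹ `Even (s + s₀ + #T)`. Modulo the Poitou–Tate fact only.
[cite: MazurRubin2007, Prop. 1.3 (i) and Thm. 1.4] [cite: KlagsbrunMazurRubin2013, Thm. 3.9] -/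
theorem even_add_add_card_of_split (hp2 : p ≠ 2)
    (hfact : poitouTate_selmerStructure_duality K)
    {S T : Finset (Place K)} (hS : ∀ w : InfinitePlace K, (Sum.inl w : Place K) ∈ S)
    (hSp : ∀ v : HeightOneSpectrum (𝓞 K), (p : 𝓞 K) ∈ v.asIdeal → (Sum.inr v : Place K) ∈ S)
    (hSbad : ∀ v : HeightOneSpectrum (𝓞 K), (Sum.inr v : Place K) ∉ S → W.HasGoodReductionAt v)
    (hTS : T ⊆ S) (hT : ∀ w : InfinitePlace K, (Sum.inl w : Place K) ∉ T)
    (hTp : ∀ v : HeightOneSpectrum (𝓞 K), (Sum.inr v : Place K) ∈ T → (p : 𝓞 K) ∉ v.asIdeal)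
    (hTsplit : ∀ v : HeightOneSpectrum (𝓞 K), (Sum.inr v : Place K) ∈ T →
      W.HasSplitMultiplicativeReductionAt v ∧
        p ∣ (W.baseChange (v.adicCompletion K)).localTamagawaNumber (v.adicCompletionIntegers K))
    (htam : ∀ v : HeightOneSpectrum (𝓞 K), (Sum.inr v : Place K) ∈ S → (Sum.inr v : Place K) ∉ T →
      (p : 𝓞 K) ∉ v.asIdeal →
      ¬ p ∣ (W.baseChange (v.adicCompletion K)).localTamagawaNumber (v.adicCompletionIntegers K))
    {s s₀ : ℕ} (hs : Nat.card (W.selmerGroup (p : ℤ)) = p ^ s)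
    (hs₀ : Nat.card (residualSelmerGroup W p) = p ^ s₀) :
    Even (s + s₀ + T.card) :=
  even_add_add_card W p hp2 hfact hS hSp hSbad hTS hT hTp htam (hterm_of_split W p hT hTp hTsplit) hs hs₀

/-! ### §4. The NO-GO form -/

/-- **(P), NO-GO form for `E[p]`**: under the hypotheses of `even_add_add_card` on `S`, `T` and the
local terms, `#Sel_p(E) = p^s` with `s + #T` odd forces `S⁰(E) ≠ ⊥`. THE N2 READING: a NOGO-parity
cell (`#Sel₃(E) = 3^s` certified, `s + #T_E` odd) has `S⁰(E) ≠ 0`, so by (X)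
(`ResidualSelmerGroup.residualSelmerGroup_eq_bot_of_not_dvd_tamagawaProduct`) no Tamagawa-`3`-free
curve shares its residual Selmer group. [cite: MazurRubin2007, Thm. 1.4] -/
theorem residualSelmerGroup_ne_bot_of_odd (hp2 : p ≠ 2)
    (hfact : poitouTate_selmerStructure_duality K)
    {S T : Finset (Place K)} (hS : ∀ w : InfinitePlace K, (Sum.inl w : Place K) ∈ S)
    (hSp : ∀ v : HeightOneSpectrum (𝓞 K), (p : 𝓞 K) ∈ v.asIdeal → (Sum.inr v : Place K) ∈ S)
    (hSbad : ∀ v : HeightOneSpectrum (𝓞 K), (Sum.inr v : Place K) ∉ S → W.HasGoodReductionAt v)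
    (hTS : T ⊆ S) (hT : ∀ w : InfinitePlace K, (Sum.inl w : Place K) ∉ T)
    (hTp : ∀ v : HeightOneSpectrum (𝓞 K), (Sum.inr v : Place K) ∈ T → (p : 𝓞 K) ∉ v.asIdeal)
    (htam : ∀ v : HeightOneSpectrum (𝓞 K), (Sum.inr v : Place K) ∈ S → (Sum.inr v : Place K) ∉ T →
      (p : 𝓞 K) ∉ v.asIdeal →
      ¬ p ∣ (W.baseChange (v.adicCompletion K)).localTamagawaNumber (v.adicCompletionIntegers K))
    (hterm : ∀ v ∈ T, Nat.card (W.kummerSelmerStructure (p : ℤ) v) =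
      p * Nat.card ↥(W.kummerSelmerStructure (p : ℤ) v ⊓ residualSelmerStructure W p v))
    {s : ℕ} (hs : Nat.card (W.selmerGroup (p : ℤ)) = p ^ s) (hodd : Odd (s + T.card)) :
    residualSelmerGroup W p ≠ ⊥ := by
  haveI : ∀ v : Place K, LocallyCompactSpace (absoluteGaloisGroup (Place.Completion v)) :=
    fun v => by haveI := absoluteGaloisGroup_compactSpace (Place.Completion v); infer_instance
  haveI : NeZero p := ⟨hp.out.ne_zero⟩
  have hodd' : Odd p := hp.out.odd_of_ne_two hp2
  haveI : ∀ v : Place K, Finite (galoisCohomology ((W.torsionGaloisModule (p : ℤ)).toLocal v) 1) :=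
    finite_galoisCohomology_toLocal W p hodd'
  have hP : ∀ w : InfinitePlace K, (Sum.inl w : Place K) ∈ S \ T :=
    fun w => Finset.mem_sdiff.mpr ⟨hS w, hT w⟩
  have hPp : ∀ v : HeightOneSpectrum (𝓞 K), (p : 𝓞 K) ∈ v.asIdeal → (Sum.inr v : Place K) ∈ S \ T :=
    fun v hv => Finset.mem_sdiff.mpr ⟨hSp v hv, fun h => hTp v h hv⟩
  obtain ⟨b, hsymm, hnd, hΛ, hX, hrec, hPT⟩ :=
    exists_groupForm_data W p hp2 hfact hS hSp hSbad hP hPp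
  refine ne_bot_of_odd_groupForm (ι := Place K) hp2
    (Summit.BirchSwinnertonDyer.Rank1Residual.Additive.smul_galH1Torsion_eq_zero W p)
    (nsmul_galoisCohomology_toLocal_eq_zero W p)
    (fun v => galoisCohomology.localization (W.torsionGaloisModule (p : ℤ)) v 1)
    (residualSelmerStructure W p) b (W.kummerSelmerStructure (p : ℤ)) hsymm hnd hΛ hX hrec hPT
    (finite_residual_outside W p hSp hSbad) subset_rfl Finset.sdiff_subset ?_ ?_ hterm
    (W.selmerGroup (p : ℤ)) (residualSelmerGroup W p)
    (mem_selmerGroup_iff_of_places W p hS hSp hSbad)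
    (mem_residualSelmerGroup_iff_of_places W p (P := S \ T) fun v hv hpv =>
      htam v (Finset.mem_sdiff.mp hv).1 (Finset.mem_sdiff.mp hv).2 hpv) hs hodd
  · intro v hv
    exact Finset.mem_sdiff.mpr ⟨hTS hv, fun h => (Finset.mem_sdiff.mp h).2 hv⟩
  · intro v hv hvT
    obtain ⟨hvS, hvP⟩ := Finset.mem_sdiff.mp hv
    exact absurd (Finset.mem_sdiff.mpr ⟨hvS, hvT⟩) hvP

/-- **NO-GO form with the local term discharged**: `T` = split multiplicative `v ∤ p` with
`p ∣ c_v`; `#Sel_p(E) = p^s`, `s + #T` odd ⟹ `S⁰(E) ≠ ⊥`. THE N2 READING: the 25 NOGO-parity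
cells. Modulo the Poitou–Tate fact only. [cite: MazurRubin2007, Thm. 1.4] -/
theorem residualSelmerGroup_ne_bot_of_odd_of_split (hp2 : p ≠ 2)
    (hfact : poitouTate_selmerStructure_duality K)
    {S T : Finset (Place K)} (hS : ∀ w : InfinitePlace K, (Sum.inl w : Place K) ∈ S)
    (hSp : ∀ v : HeightOneSpectrum (𝓞 K), (p : 𝓞 K) ∈ v.asIdeal → (Sum.inr v : Place K) ∈ S)
    (hSbad : ∀ v : HeightOneSpectrum (𝓞 K), (Sum.inr v : Place K) ∉ S → W.HasGoodReductionAt v)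
    (hTS : T ⊆ S) (hT : ∀ w : InfinitePlace K, (Sum.inl w : Place K) ∉ T)
    (hTp : ∀ v : HeightOneSpectrum (𝓞 K), (Sum.inr v : Place K) ∈ T → (p : 𝓞 K) ∉ v.asIdeal)
    (hTsplit : ∀ v : HeightOneSpectrum (𝓞 K), (Sum.inr v : Place K) ∈ T →
      W.HasSplitMultiplicativeReductionAt v ∧
        p ∣ (W.baseChange (v.adicCompletion K)).localTamagawaNumber (v.adicCompletionIntegers K))
    (htam : ∀ v : HeightOneSpectrum (𝓞 K), (Sum.inr v : Place K) ∈ S → (Sum.inr v : Place K) ∉ T →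
      (p : 𝓞 K) ∉ v.asIdeal →
      ¬ p ∣ (W.baseChange (v.adicCompletion K)).localTamagawaNumber (v.adicCompletionIntegers K))
    {s : ℕ} (hs : Nat.card (W.selmerGroup (p : ℤ)) = p ^ s) (hodd : Odd (s + T.card)) :
    residualSelmerGroup W p ≠ ⊥ :=
  residualSelmerGroup_ne_bot_of_odd W p hp2 hfact hS hSp hSbad hTS hT hTp htam
    (hterm_of_split W p hT hTp hTsplit) hs hodd

end Summit.BirchSwinnertonDyer.Rank1Residual.X10.ResidualSelmerParityInstance

end
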